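import Summits.QuantumFields.YangMills.Theorems.UnitScaleTiltProp7DivRecoveryPatchRowsOne
import Summits.QuantumFields.YangMills.Theorems.UnitScaleTiltProp7DivRecoveryPatchFeeds
import Summits.QuantumFields.YangMills.Theorems.UnitScaleTiltProp7DescentStraightCloseness
import Summits.QuantumFields.YangMills.Theorems.UnitScaleTiltProp7DivRecoveryMemberWindows
import Summits.QuantumFields.YangMills.Theorems.UnitScaleTiltProp7BoxPullbackPlaqSmall
import Summits.QuantumFields.YangMills.Theorems.UnitScaleTiltProp7DbarTwWindow
import HarnessLib

/-!
# Route `UnitScaleTilt`, crux K1 «MinimiserStabilityRegPr» (stmt-QuantumFields-19200), LANE II [I-9] PATCHES1 — **`patch_rows` : THE PER-PATCH SCHEMA `hP1` OF px12's PATCHES2**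
# (★p1 g20 14:15:13Z: pen → px9 g8; w1-19200 g16 CORE ⧗p724377, px4 g9 FEEDS ✓p726284, px9 PEEL ✓ + W1 `patch_rows_one`).

Cell `ym3-torus`, width seat `ym3-torus-px9` (gen 8).  THEOREMS ONLY (0 `def`, 0 `sorry`); `--supports stmt-QuantumFields-19200 --as helper`; count-neutral.
YM₃ on T³ is rung R3 — NOT d = 4, NOT infinite volume, NOT a mass gap, NOT Clay; nothing here claims (REC)∕`hN06`∕EX∕the crux beyond the displayed (QH1)♮ hypothesis.

WHAT IS PROVED.  ★★★`patch_rows (c₀ cB) (hQH1) : hP1` — the `hP1` binder of ✓p724687 `Prop7DivRecoveryAssemblyPatches2.hPatch_of_patchRows` VERBATIM (★p1 g20's probe text), from the one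
displayed hypothesis `hQH1` = ✓p718170 `hQH1_of_sectors`'s conclusion at `H := H_door` applied.  Plumbing only: constants chosen per `L` (`cL cMR cHM` s-free) and per `s ≥ s₀ := 2`
(the ten s-dependent coefficients = ✓`patch_rows_one`'s written-out budget coefficients at `A = 1`, `Cc = 2`), `eP := min` of the nine windows; per patch `g`: corner centre
`c = ↑(g·L^s·ℓ)`, block `C = ↑(g·L^s)` (✓`corner_eq_centre`, ✓`iterBlockOf_corner`), record box (✓`two_mul_recordRadius_add_one_le`, ✓`recordRadius_le`, ✓`transl_injOn_box`),
`V := W♮∘transl basePt`, `α := regThreshold` (✓(P-box), ✓`member_windows_of_le`), `T := descendToGL` (✓`descent_straight_closeness`, SU(2)-valued by ✓`…of_regPr`), the three FEEDS by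
name, then ✓`patch_rows_one` and `exact`.

References: T. Bałaban, CMP **99** (1985) 389–434 [Balaban1985BackgroundPropagators] ((3.19)-(3.26) pp.393-395, (3.100) pp.413-414).
-/

set_option autoImplicit false

noncomputable section

open scoped InnerProductSpace Matrix.Norms.L2Operator BigOperators

namespace Summit.QuantumFields.YangMills.Theorems.Prop7DivRecoveryPatchRows

open Literature.MathematicalPhysics.QuantumFieldTheory.Balaban1983to89
open Literature.MathematicalPhysics.QuantumFieldTheory.Balaban1983to89.T3ContinuumYM3Torus
open B11Eq103H1Complex (SiteL2K BondL2K)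
open B10Eq27TorusAxialLog (transl unitsField toUField)
open B4Eq19LatticeOperators (Zd box unitVec)
open B7Eq78Linearization (conjR)
open B7Prop1Explicit (U1)
open B7Prop2Explicit (C0 c2' C0_pos c2'_pos)
open B9TorusCalculus (torusT)
open B9Eq39Adjoint (curl)
open B9Eq311L2Pairing (WL2)
open B5Eq118OneStroke (iterBlockOf)
open T3SectALandauChart (eta eta_pos bgUnits)
open T3PrintedRegularMinimiser (RegPr)
open T3PrintedRegularOrbits (sites_eq)
open T3LevelShift (bondShift)
open T3RegularMinimiser (regThreshold)
open Summit.QuantumFields.YangMills.Theorems.Prop7SymAvgGL (descendToGL)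
open Summit.QuantumFields.YangMills.Theorems.Prop7QprimeCombL2 (QprimeCombL2)
open Summit.QuantumFields.YangMills.Theorems.Prop7SectET3Transport (periodsT3)
open Summit.QuantumFields.YangMills.Theorems.Prop7SectET3HilbertLetters (W₂ frobEquiv toL2 toL2S DL2 DstarL2 covLapSite)
open Summit.QuantumFields.YangMills.Theorems.Prop7SectET3CombLetters (Qkc)
open Summit.QuantumFields.YangMills.Theorems.Prop7SPrint (basePt)
open Summit.QuantumFields.YangMills.Theorems.Prop7DivRecoveryPatchRowsOne (patch_rows_one)
open Summit.QuantumFields.YangMills.Theorems.Prop7TiledCubeMemberH7H8PeeledIndex (cycDist_src_le_of_mem_image)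
open Summit.QuantumFields.YangMills.Theorems.Prop7DivRecoveryPatchFeeds (feedN hT_bondPatch feedCu feedCuW feedAs feedBoxS)
open Summit.QuantumFields.YangMills.Theorems.Prop7QkcInnerPatchRows (coarseGrad_rows_on_inner)
open Summit.QuantumFields.YangMills.Theorems.Prop7DescentStraightCloseness (descent_straight_closeness)
open Summit.QuantumFields.YangMills.Theorems.Prop7Lane2PlateauCutoff (corner_eq_centre)
open Summit.QuantumFields.YangMills.Theorems.Prop7Lane2ChartInGrid (iterBlockOf_corner)
open Summit.QuantumFields.YangMills.Theorems.Prop7Lane2SupportInChart (two_mul_recordRadius_add_one_le)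
open Summit.QuantumFields.YangMills.Theorems.Prop7DivRecoveryCutoffReadings (recordRadius_le)
open Summit.QuantumFields.YangMills.Theorems.Prop7BoxChartTransport (transl_injOn_box)
open Summit.QuantumFields.YangMills.Theorems.Prop7BoxPullbackPlaqSmall (plaqSmall_of_regPr_of_eq_transl regThreshold_eq_mul_eta_sq)
open Summit.QuantumFields.YangMills.Theorems.Prop7DivRecoveryMemberWindows (member_windows_of_le)
open Summit.QuantumFields.YangMills.Theorems.Prop7DbarTwWindow (descendToGL_bgUnits_mem_specialUnitaryUnits_of_regPr)
open B7Prop2SpecialUnitary (specialUnitaryUnits_le_U1)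

/-- ★ **THE PEELED INDEX SET CARRIES THE BOX-PLATEAU MARGIN** (`hSC` of ⧗`patch_rows_core` ∕ ✓`feedAs` at the image set `ι(C(B′ − (2L^s+1) + 5, 4L^s − 8))` of
✓`h7h8_member_peeled`): every source is within coarse cyclic sup-distance `2L^s − 3` of the block `C` — ✓px9 6c §1 `cycDist_src_le_of_mem_image` at `B := B′ + 1`
▸ ✓w1 `dist_add_three_le_of_cycDist_cornerBlock` (his seam certificate, now a theorem). [cite: Balaban1985BackgroundPropagators, (3.100) p.413] -/
theorem peeled_margin (F : T3Family) (n K s : ℕ) (hnK : n < K) (hR2 : 2 ≤ F.L ^ s)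
    (C : Site (F.P K) (K - n)) (c : Site (F.P K) 0)
    (hc : ∀ κ : Fin 3, c κ = (((C κ).val * F.L ^ (K - n) : ℕ) : ZMod ((F.P K).sitesPerDir 0))) :
    ∀ chat ∈ (((Fintype.piFinset (fun i => Finset.Icc ((fun i : Fin (F.P K).d => ((((((c i).val : ℕ) : ℤ) - ((((basePt F n K) i).val : ℕ) : ℤ)) / ((F.L ^ (K - n) : ℕ) : ℤ) - (2 * ((F.L ^ s : ℕ) : ℤ) + 1)) + ((5 : ℕ) : ℤ))) i) ((fun i : Fin (F.P K).d => ((((((c i).val : ℕ) : ℤ) - ((((basePt F n K) i).val : ℕ) : ℤ)) / ((F.L ^ (K - n) : ℕ) : ℤ) - (2 * ((F.L ^ s : ℕ) : ℤ) + 1)) + ((5 : ℕ) : ℤ))) i + ((4 * F.L ^ s + 2 - 2 * 5 : ℕ) : ℤ)))) ×ˢ (Finset.univ : Finset (Fin (F.P K).d))).filter (fun q => q.1 + B7Prop1Explicit.e q.2 ∈ Fintype.piFinset (fun i => Finset.Icc ((fun i : Fin (F.P K).d => ((((((c i).val : ℕ) : ℤ) - ((((basePt F n K) i).val : ℕ)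 : ℤ)) / ((F.L ^ (K - n) : ℕ) : ℤ) - (2 * ((F.L ^ s : ℕ) : ℤ) + 1)) + ((5 : ℕ) : ℤ))) i) ((fun i : Fin (F.P K).d => ((((((c i).val : ℕ) : ℤ) - ((((basePt F n K) i).val : ℕ) : ℤ)) / ((F.L ^ (K - n) : ℕ) : ℤ) - (2 * ((F.L ^ s : ℕ) : ℤ) + 1)) + ((5 : ℕ) : ℤ))) i + ((4 * F.L ^ s + 2 - 2 * 5 : ℕ) : ℤ))))).image (fun q => (⟨transl (0 : Site (F.P K) (K - n)) q.1, q.2⟩ : PBond (F.P K) (K - n))),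
      ∀ κ : Fin 3, min (chat.src κ - C κ).val (C κ - chat.src κ).val + 3 ≤ 2 * F.L ^ s := by
  have hblk := Summit.QuantumFields.YangMills.Theorems.Prop7Lane2BoxPlateauPeel.cornerBlock_eq F n K C c hc hnK
  intro chat hchat
  refine Summit.QuantumFields.YangMills.Theorems.Prop7Lane2BoxPlateauPeel.dist_add_three_le_of_cycDist_cornerBlock F n K s C c hc hnK (2 * F.L ^ s - 3) (by omega) chat
    (cycDist_src_le_of_mem_image F n K _
      (fun κ => (((((c κ).val : ℕ) : ℤ) - ((((basePt F n K) κ).val : ℕ) : ℤ)) / ((F.L ^ (K - n) : ℕ) : ℤ) + 1)) _ (2 * F.L ^ s - 3)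
      (fun κ => ?_) (fun κ => ?_) chat hchat)
  · have := hblk κ; simp only [this]; omega
  · have := hblk κ; simp only [this]; omega



set_option maxHeartbeats 400000 in
-- hb: one `patch_rows_one` call with sixty written-out arguments and the 18-conjunct constructor over hP1's displayed rows (whnf of the record letters)
/-- ★★★ **[I-9] PATCHES1 — `hP1`, THE PER-PATCH SCHEMA OF ✓`hPatch_of_patchRows`, FROM (QH1)♮.** See the module docstring.
[cite: Balaban1985BackgroundPropagators, (3.19)-(3.26) pp.393-395, (3.100) pp.413-414] -/
theorem patch_rows (c₀ cB : ℕ → ℝ) [hc₀ : ∀ L : ℕ, Fact (0 < c₀ L)] [hcB : ∀ L : ℕ, Fact (0 < cB L)]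
    (hQH1 : ∀ (L : ℕ), 1 < L → ∃ B B' B'' eQ : ℝ, 0 ≤ B ∧ 0 ≤ B' ∧ 0 ≤ B'' ∧ 0 < eQ ∧
          ∀ (F : T3Family), F.L = L → ∀ (n K : ℕ) (hnK : n < K) (e : ℝ) (W : GaugeField (F.P K) 0 (Matrix.specialUnitaryGroup (Fin 2) ℂ)),
            0 < e → e ≤ eQ → RegPr F n K e W →
            ∀ f : BondL2K ℂ 3 (periodsT3 F K) (c₀ F.L) W₂,
              (c₀ F.L / cB F.L) * ((F.L : ℝ) ^ (K - n)) ^ 3 * ‖Qkc F n K hnK.le (c₀ F.L) (cB F.L) W f‖ ^ 2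
                ≤ B * ‖f‖ ^ 2 + B' * (fun (F : T3Family) (n K : ℕ) (W : GaugeField (F.P K) 0 (Matrix.specialUnitaryGroup (Fin 2) ℂ)) (f : BondL2K ℂ 3 (periodsT3 F K) (c₀ F.L) W₂) =>
                  c₀ F.L * ((F.L : ℝ) ^ (K - n)) ^ 2 * (∑ x : Site (F.P K) 0, ∑ μ : Fin (F.P K).d, ∑ ν : Fin (F.P K).d,
                  (if μ < ν then ∑ j : Fin 2, ∑ k : Fin 2,
                  ‖(curl (torusT (F.P K) 0) (fun κ z => unitsField (toUField W) ⟨z, κ⟩) (fun κ z => (toL2 F K (c₀ F.L)).symm f ⟨z, κ⟩) μ ν x) j k‖ ^ 2 else 0))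
                  + ‖DstarL2 F n K (c₀ F.L) W f‖ ^ 2) F n K W f + B'' * e * ‖f‖ ^ 2) :
    ∀ (L : ℕ), 1 < L → ∃ cL cMR cHM : ℝ, 0 ≤ cL ∧ 0 ≤ cMR ∧ 0 ≤ cHM ∧ ∃ s₀ : ℕ, ∀ s : ℕ, s₀ ≤ s →
        ∃ cΦ cρCu cρN cKCu cKN cMAs cMCu cMe cHCu cHN eP : ℝ,
          0 ≤ cΦ ∧ 0 ≤ cρCu ∧ 0 ≤ cρN ∧ 0 ≤ cKCu ∧ 0 ≤ cKN ∧ 0 ≤ cMAs ∧ 0 ≤ cMCu ∧ 0 ≤ cMe ∧ 0 ≤ cHCu ∧ 0 ≤ cHN ∧ 0 < eP ∧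
          ∀ (F : T3Family), F.L = L → ∀ (n K : ℕ) (hnK : n < K) (e : ℝ) (W : GaugeField (F.P K) 0 (Matrix.specialUnitaryGroup (Fin 2) ℂ)),
            s < F.m + n → 0 < e → e ≤ eP → RegPr F n K e W →
            ∀ (y : BondL2K ℂ 3 (periodsT3 F K) (c₀ F.L) W₂),
            ∀ g ∈ (Fintype.piFinset fun _ : Fin 3 => Finset.range (2 * F.L ^ (F.m + n - s))),
            ∀ (ζc : Site (F.P K) 0 → ℝ) (Z : SiteL2K ℂ 3 (periodsT3 F K) (c₀ F.L) W₂ →ₗ[ℂ] SiteL2K ℂ 3 (periodsT3 F K) (c₀ F.L) W₂)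
              (ZE : BondL2K ℂ 3 (periodsT3 F K) (c₀ F.L) W₂ →ₗ[ℂ] BondL2K ℂ 3 (periodsT3 F K) (c₀ F.L) W₂),
              (∀ x, 0 ≤ ζc x ∧ ζc x ≤ 1) →
              (∀ x, ζc x ≠ 0 → ∀ κ : Fin 3, min (x κ - ((g κ * (F.L ^ s * F.L ^ (K - n)) : ℕ) : ZMod ((F.P K).sitesPerDir 0))).val (((g κ * (F.L ^ s * F.L ^ (K - n)) : ℕ) : ZMod ((F.P K).sitesPerDir 0)) - x κ).val < F.L ^ s * F.L ^ (K - n)) →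
              (∀ x (μ : Fin 3), |ζc (x.shift μ) - ζc x| ≤ 3 / 2 / ((F.L : ℝ) ^ s * (F.L : ℝ) ^ (K - n)) ∧ |ζc (x.unshift μ) - ζc x| ≤ 3 / 2 / ((F.L : ℝ) ^ s * (F.L : ℝ) ^ (K - n))) →
              (∀ x (μ : Fin 3), |ζc (x.shift μ) + ζc (x.unshift μ) - 2 * ζc x| ≤ 6 / ((F.L : ℝ) ^ s * (F.L : ℝ) ^ (K - n)) ^ 2) →
              (∀ φ x, (toL2S F K (c₀ F.L)).symm (Z φ) x = ζc x • (toL2S F K (c₀ F.L)).symm φ x) →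
              (∀ f b, (toL2 F K (c₀ F.L)).symm (ZE f) b = ζc b.src • (toL2 F K (c₀ F.L)).symm f b) →
              ∃ (φ κs : SiteL2K ℂ 3 (periodsT3 F K) (c₀ F.L) W₂) (r : BondL2K ℂ 3 (periodsT3 F K) (c₀ F.L) W₂) (N Cu As : ℝ),
                Z (DstarL2 F n K (c₀ F.L) W y) = Z (covLapSite F n K (c₀ F.L) W φ) + Z κs ∧
                ZE (DL2 F n K (c₀ F.L) W φ) = ZE y - ZE r ∧
                ‖φ‖ ^ 2 ≤ cΦ * ((F.L : ℝ) ^ s) ^ 2 * N ∧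
                ‖r‖ ^ 2 ≤ cρCu * Cu + cρN * e * N ∧
                ‖Z κs‖ ^ 2 ≤ cKCu * Cu + cKN * e * N ∧
                ‖covLapSite F n K (c₀ F.L) W (Z φ) - Z (covLapSite F n K (c₀ F.L) W φ)‖ ^ 2 ≤ cL * ((F.L : ℝ) ^ s)⁻¹ ^ 2 * N ∧
                ‖DL2 F n K (c₀ F.L) W (Z φ) - ZE (DL2 F n K (c₀ F.L) W φ)‖ ^ 2
                  ≤ cMAs * As + cMCu * Cu + (cMR * ((F.L : ℝ) ^ s)⁻¹ ^ 2 + cMe * e) * N ∧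
                (c₀ F.L * ((F.L : ℝ) ^ (K - n)) ^ 2 * (∑ x : Site (F.P K) 0, ∑ μ : Fin (F.P K).d, ∑ ν : Fin (F.P K).d, (if μ < ν then ∑ j : Fin 2, ∑ k : Fin 2, ‖(curl (torusT (F.P K) 0) (fun κ z => unitsField (toUField W) ⟨z, κ⟩) (fun κ z => (toL2 F K (c₀ F.L)).symm (ZE r) ⟨z, κ⟩) μ ν x) j k‖ ^ 2 else 0)) + ‖DstarL2 F n K (c₀ F.L) W (ZE r)‖ ^ 2)
                  ≤ cHCu * Cu + cHN * e * N ∧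
                (c₀ F.L * ((F.L : ℝ) ^ (K - n)) ^ 2 * (∑ x : Site (F.P K) 0, ∑ μ : Fin (F.P K).d, ∑ ν : Fin (F.P K).d, (if μ < ν then ∑ j : Fin 2, ∑ k : Fin 2, ‖(curl (torusT (F.P K) 0) (fun κ z => unitsField (toUField W) ⟨z, κ⟩) (fun κ z => (toL2 F K (c₀ F.L)).symm (DL2 F n K (c₀ F.L) W (Z φ) - ZE (DL2 F n K (c₀ F.L) W φ)) ⟨z, κ⟩) μ ν x) j k‖ ^ 2 else 0)) + ‖DstarL2 F n K (c₀ F.L) W (DL2 F n K (c₀ F.L) W (Z φ) - ZE (DL2 F n K (c₀ F.L) W φ))‖ ^ 2)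
                  ≤ cHM * ((F.L : ℝ) ^ s)⁻¹ ^ 2 * N ∧
                N ≤ ∑ b ∈ Finset.univ.filter (fun b : PBond (F.P K) 0 => ∀ κ : Fin 3,
                    min ((iterBlockOf (K - n) b.src) κ - ((g κ * F.L ^ s : ℕ) : ZMod ((F.P K).sitesPerDir (K - n)))).val
                      ((((g κ * F.L ^ s : ℕ) : ZMod ((F.P K).sitesPerDir (K - n)))) - (iterBlockOf (K - n) b.src) κ).val ≤ 2 * F.L ^ s + 2), c₀ F.L * ‖(frobEquiv.symm ((toL2 F K (c₀ F.L)).symm y b) : W₂)‖ ^ 2 ∧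
                Cu ≤ ∑ x ∈ Finset.univ.filter (fun x : Site (F.P K) 0 => ∀ κ : Fin 3,
                    min ((iterBlockOf (K - n) x) κ - ((g κ * F.L ^ s : ℕ) : ZMod ((F.P K).sitesPerDir (K - n)))).val
                      ((((g κ * F.L ^ s : ℕ) : ZMod ((F.P K).sitesPerDir (K - n)))) - (iterBlockOf (K - n) x) κ).val ≤ 2 * F.L ^ s + 2),
                  c₀ F.L * ((F.L : ℝ) ^ (K - n)) ^ 2 * ∑ μ : Fin (F.P K).d, ∑ ν : Fin (F.P K).d, (if μ < ν then ∑ j : Fin 2, ∑ k : Fin 2,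
                    ‖(curl (torusT (F.P K) 0) (fun κ z => unitsField (toUField W) ⟨z, κ⟩) (fun κ z => (toL2 F K (c₀ F.L)).symm y ⟨z, κ⟩) μ ν x) j k‖ ^ 2 else 0) ∧
                As ≤ ∑ c ∈ Finset.univ.filter (fun c : PBond (F.P K) (K - n) => ∀ κ : Fin 3,
                    min ((c.src) κ - ((g κ * F.L ^ s : ℕ) : ZMod ((F.P K).sitesPerDir (K - n)))).val
                      ((((g κ * F.L ^ s : ℕ) : ZMod ((F.P K).sitesPerDir (K - n)))) - (c.src) κ).val ≤ 2 * F.L ^ s + 2),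
                  (c₀ F.L / cB F.L) * ((F.L : ℝ) ^ (K - n)) ^ 3 * (cB F.L * ‖WL2.equiv ℂ (fun _ : PBond (F.P n) 0 => cB F.L) W₂
                    (Qkc F n K hnK.le (c₀ F.L) (cB F.L) W y) ((bondShift (sites_eq F n K hnK.le)).symm c)‖ ^ 2) := by
  intro L hL
  obtain ⟨Bq, Bq', Bq'', eQ, hBq, hBq', hBq'', heQ, hQL⟩ := hQH1 L hL
  obtain ⟨C3, e9, hC3, he9, hrow9L⟩ := coarseGrad_rows_on_inner c₀ cB L hL
  obtain ⟨CT, e3, hCT, he3, hcloseL⟩ := descent_straight_closeness L hL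
  have hL0r : (0 : ℝ) < (L : ℝ) := by exact_mod_cast (by omega : 0 < L)
  have hc2 : 0 < c2' 3 L := c2'_pos 3 L (by omega)
  have hC0 : 0 < C0 3 := C0_pos 3
  have hc0L : 0 < c₀ L := (hc₀ L).out
  have hcBL : 0 < cB L := (hcB L).out
  refine ⟨972 * (1 + 576), (27 / 4) * (1106568 + 87360 * 576), 4536 * (1 + 576), by norm_num, by norm_num, by norm_num, 2, fun s hs2 => ?_⟩
  refine ⟨576,
    (1944 * 2) * ((L : ℝ) ^ s) ^ 2,
    (20155392 * 1 ^ 2) * ((L : ℝ) ^ s) ^ 4,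
    (13824 * 1 ^ 2) * (1944 * 2) * ((L : ℝ) ^ s) ^ 4,
    (13824 * 1 ^ 2) * (20155392 * 1 ^ 2) * ((L : ℝ) ^ s) ^ 6,
    4 * (27 / 4) * 672,
    (27 / 4) * 672 * (((4 * (Bq + Bq'') + 4 * Bq' * (24 + 432 * 1 ^ 2 + 48 * (2 * (L : ℝ) ^ s) ^ 2) * ((L : ℝ) ^ s)⁻¹ ^ 2) + (4 * Bq' * (24 + 432 * 1 ^ 2 + 48 * (2 * (L : ℝ) ^ s) ^ 2)) * (13824 * 1 ^ 2) * ((L : ℝ) ^ s) ^ 2) * (1944 * 2) * ((L : ℝ) ^ s) ^ 2 + (4 * Bq' * (24 + 432 * 1 ^ 2 + 48 * (2 * (L : ℝ) ^ s) ^ 2))),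
    ((27 / 4) * (1106568 + 87360 * 576) * 576 + (27 / 4) * 672 * (4 * Bq' * (24 + 432 * 1 ^ 2 + 48 * (2 * (L : ℝ) ^ s) ^ 2) + C3 * (c₀ L / cB L)) * 576 * ((L : ℝ) ^ s) ^ 2 + (27 / 4) * (7648598016 * 1 ^ 2 + 4032 * ((2 * CT + 29568) ^ 2 + 29484 ^ 2)) * 576 * ((L : ℝ) ^ s) ^ 4
        + (27 / 4) * 672 * ((4 * (Bq + Bq'') + 4 * Bq' * (24 + 432 * 1 ^ 2 + 48 * (2 * (L : ℝ) ^ s) ^ 2) * ((L : ℝ) ^ s)⁻¹ ^ 2) + (4 * Bq' * (24 + 432 * 1 ^ 2 + 48 * (2 * (L : ℝ) ^ s) ^ 2)) * (13824 * 1 ^ 2) * ((L : ℝ) ^ s) ^ 2) * (20155392 * 1 ^ 2) * ((L : ℝ) ^ s) ^ 4),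
    (24 + 432 * 1 ^ 2 + 48 * (3 / 2) ^ 2) * (1 + (1944 * 2) + (13824 * 1 ^ 2) * (1944 * 2) * ((L : ℝ) ^ s) ^ 4),
    (24 + 432 * 1 ^ 2 + 48 * (3 / 2) ^ 2) * (576 * ((L : ℝ) ^ s) ^ 2 + (20155392 * 1 ^ 2) * ((L : ℝ) ^ s) ^ 2 + (13824 * 1 ^ 2) * (20155392 * 1 ^ 2) * ((L : ℝ) ^ s) ^ 6),
    min (min (min (min (min (min (min (min 1 eQ) e9) e3) (10 ^ 9 * (L : ℝ) ^ 3)⁻¹) (((L : ℝ) ^ s) ^ 2)⁻¹) (5396 * ((L : ℝ) ^ s) ^ 2)⁻¹) (6 * C0 3)⁻¹) (c2' 3 L / 4),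
    by norm_num, by positivity, by positivity, by positivity, by positivity, by positivity, by positivity, by positivity,
    by positivity, by positivity, by positivity, ?_⟩
  intro F hF n K hnK e W hsm he heP hreg y g hg ζc Z ZE h01 hsupp hstep hsec hZ hZE
  subst hF
  have hc0 : 0 < c₀ F.L := (hc₀ F.L).out
  have hcB0 : 0 < cB F.L := (hcB F.L).out
  -- ### the nine windows of `eP`
  have he1 : e ≤ 1 := heP.trans (by simp only [min_le_iff, le_refl, true_or])
  have heQ' : e ≤ eQ := heP.trans (by simp only [min_le_iff, le_refl, true_or, or_true])
  have he9' : e ≤ e9 := heP.trans (by simp only [min_le_iff, le_refl, true_or, or_true])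
  have he3' : e ≤ e3 := heP.trans (by simp only [min_le_iff, le_refl, true_or, or_true])
  have hw9' : e ≤ (10 ^ 9 * (F.L : ℝ) ^ 3)⁻¹ := heP.trans (by simp only [min_le_iff, le_refl, true_or, or_true])
  have hew' : e ≤ (((F.L : ℝ) ^ s) ^ 2)⁻¹ := heP.trans (by simp only [min_le_iff, le_refl, true_or, or_true])
  have hwin' : e ≤ (5396 * ((F.L : ℝ) ^ s) ^ 2)⁻¹ := heP.trans (by simp only [min_le_iff, le_refl, true_or, or_true])
  have he4 : e ≤ min (6 * C0 3)⁻¹ (c2' 3 F.L / 4) := le_min (heP.trans (by simp only [min_le_iff, le_refl, true_or, or_true])) (heP.trans (min_le_right _ _))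
  have hL0 : 0 < F.L := by omega
  have hw9 : 10 ^ 9 * (F.L : ℝ) ^ 3 * e ≤ 1 := by
    have hpos : (0 : ℝ) < 10 ^ 9 * (F.L : ℝ) ^ 3 := by positivity
    calc 10 ^ 9 * (F.L : ℝ) ^ 3 * e ≤ 10 ^ 9 * (F.L : ℝ) ^ 3 * (10 ^ 9 * (F.L : ℝ) ^ 3)⁻¹ := mul_le_mul_of_nonneg_left hw9' hpos.le
      _ = 1 := mul_inv_cancel₀ hpos.ne'
  have hw7 : 10 ^ 7 * (F.L : ℝ) ^ 3 * e ≤ 1 := by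
    refine le_trans ?_ hw9
    have : (0 : ℝ) ≤ (F.L : ℝ) ^ 3 * e := by positivity
    nlinarith
  have hew : e * ((F.L : ℝ) ^ s) ^ 2 ≤ 1 := by
    have hpos : (0 : ℝ) < ((F.L : ℝ) ^ s) ^ 2 := by positivity
    calc e * ((F.L : ℝ) ^ s) ^ 2 ≤ (((F.L : ℝ) ^ s) ^ 2)⁻¹ * ((F.L : ℝ) ^ s) ^ 2 := mul_le_mul_of_nonneg_right hew' hpos.le
      _ = 1 := inv_mul_cancel₀ hpos.ne'
  -- ### the floor `s₀ = 2`: `5 ≤ 9 ≤ L^s`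
  have hL3 : 3 ≤ F.L := by obtain ⟨r, hr⟩ := F.hL.1; omega
  have hR5 : 5 ≤ F.L ^ s :=
    calc 5 ≤ 3 ^ 2 := by norm_num
      _ ≤ F.L ^ 2 := Nat.pow_le_pow_left hL3 2
      _ ≤ F.L ^ s := Nat.pow_le_pow_right hL0 hs2
  have hR2 : 2 ≤ F.L ^ s := le_trans (by norm_num) hR5
  have hℓ1 : 1 ≤ F.L ^ (K - n) := Nat.one_le_pow _ _ hL0
  have hℓ4 : 4 ≤ F.L ^ s * F.L ^ (K - n) := le_trans (le_trans (by norm_num) hR5) (Nat.le_mul_of_pos_right _ hℓ1)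
  -- ### the patch: corner centre `c = ↑(g·L^s·ℓ)`, grid block `C = ↑(g·L^s)`, the record chart box `(z_c, R_f)`
  have hg' : ∀ κ, g κ < 2 * F.L ^ (F.m + n - s) := fun κ => Finset.mem_range.mp (Fintype.mem_piFinset.mp hg κ)
  have hcorner := corner_eq_centre F n K s hnK.le hsm.le g hg'
  have hc : ∀ κ : Fin 3, (fun κ => ((g κ * (F.L ^ s * F.L ^ (K - n)) : ℕ) : ZMod ((F.P K).sitesPerDir 0)) : Site (F.P K) 0) κ = (((((fun κ => ((g κ * F.L ^ s : ℕ) : ZMod ((F.P K).sitesPerDir (K - n))) : Site (F.P K) (K - n)) κ).val * F.L ^ (K - n) : ℕ) : ZMod ((F.P K).sitesPerDir 0))) :=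
    fun κ => (congrFun hcorner κ).symm
  have hcg := iterBlockOf_corner F n K s hnK.le hsm.le g hg'
  have hRN := two_mul_recordRadius_add_one_le F n K s hnK.le hsm hR2
  have hℓ1z : (1 : ℤ) ≤ ((F.L ^ (K - n) : ℕ) : ℤ) := by exact_mod_cast hℓ1
  have hR2z : (2 : ℤ) ≤ ((F.L ^ s : ℕ) : ℤ) := by exact_mod_cast hR2
  have hhalf : (0 : ℤ) ≤ (((F.L ^ (K - n) : ℕ) : ℤ) - 1) / 2 := Int.ediv_nonneg (by omega) (by norm_num)
  have hR1 : (1 : ℤ) ≤ ((2 * ((F.L ^ s : ℕ) : ℤ) + 1) * ((F.L ^ (K - n) : ℕ) : ℤ) + (((F.L ^ (K - n) : ℕ) : ℤ) - 1) / 2) := by nlinarith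
  have hR : (0 : ℤ) ≤ ((2 * ((F.L ^ s : ℕ) : ℤ) + 1) * ((F.L ^ (K - n) : ℕ) : ℤ) + (((F.L ^ (K - n) : ℕ) : ℤ) - 1) / 2) := le_trans (by norm_num) hR1
  have hRf := recordRadius_le F K n s
  have hinj := transl_injOn_box (basePt F n K) (z := (fun κ : Fin (F.P K).d => ((F.L ^ (K - n) : ℕ) : ℤ) * ((((((fun κ => ((g κ * (F.L ^ s * F.L ^ (K - n)) : ℕ) : ZMod ((F.P K).sitesPerDir 0)) : Site (F.P K) 0) κ).val : ℕ) : ℤ) - ((((basePt F n K) κ).val : ℕ) : ℤ)) / ((F.L ^ (K - n) : ℕ) : ℤ)) + (((F.L ^ (K - n) : ℕ) : ℤ) - 1) / 2)) hRN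
  -- ### the pull-back connection `V := W♮ ∘ transl basePt`, `α := regThreshold`, the (P-box) datum and the member windows
  have hα : 0 ≤ regThreshold F n K e := by rw [regThreshold_eq_mul_eta_sq]; positivity
  have hαe' : regThreshold F n K e ≤ e * eta F n K ^ 2 := (regThreshold_eq_mul_eta_sq F n K e).le
  have hαe : regThreshold F n K e ≤ 1 * e * eta F n K ^ 2 := by rw [one_mul]; exact hαe'
  have hP := plaqSmall_of_regPr_of_eq_transl F n K hreg (basePt F n K)
    (fun w μ => unitsField (toUField W) ⟨transl (basePt F n K) w, μ⟩) (fun _ _ => rfl)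
    (fun i => (fun κ : Fin (F.P K).d => ((F.L ^ (K - n) : ℕ) : ℤ) * ((((((fun κ => ((g κ * (F.L ^ s * F.L ^ (K - n)) : ℕ) : ZMod ((F.P K).sitesPerDir 0)) : Site (F.P K) 0) κ).val : ℕ) : ℤ) - ((((basePt F n K) κ).val : ℕ) : ℤ)) / ((F.L ^ (K - n) : ℕ) : ℤ)) + (((F.L ^ (K - n) : ℕ) : ℤ) - 1) / 2) i - ((2 * ((F.L ^ s : ℕ) : ℤ) + 1) * ((F.L ^ (K - n) : ℕ) : ℤ) + (((F.L ^ (K - n) : ℕ) : ℤ) - 1) / 2)) (fun i => (fun κ : Fin (F.P K).d => ((F.L ^ (K - n) : ℕ) : ℤ) * ((((((fun κ => ((g κ * (F.L ^ s * F.L ^ (K - n)) : ℕ) : ZMod ((F.P K).sitesPerDir 0)) : Site (F.P K) 0) κ).val : ℕ) : ℤ) - ((((basePt F n K) κ).val : ℕ) : ℤ)) / ((F.L ^ (K - n) : ℕ) : ℤ)) + (((F.L ^ (K - n) : ℕ) : ℤ) - 1) / 2) i + ((2 * ((F.L ^ s : ℕ) : ℤ) + 1) * ((F.L ^ (K - n)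 : ℕ) : ℤ) + (((F.L ^ (K - n) : ℕ) : ℤ) - 1) / 2))
  obtain ⟨hw, hw4⟩ := member_windows_of_le F n K s he.le hwin' hα hαe'
  -- ### transporter `T := descendToGL` (SU(2)-valued ⇒ `U1`), its (B3c) closeness, (QH1)♮ and ✓`coarseGrad_rows_on_inner` at this member
  have hTU1 : ∀ ĉ : PBond (F.P K) (K - n),
      descendToGL F n K hnK.le (bgUnits F K W) ((bondShift (sites_eq F n K hnK.le)).symm ĉ) ∈ U1 (Matrix (Fin 2) (Fin 2) ℂ) :=
    fun ĉ => specialUnitaryUnits_le_U1 (descendToGL_bgUnits_mem_specialUnitaryUnits_of_regPr F hnK.le he hw7 W hreg _)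
  have hclose := hcloseL F rfl n K hnK e he he3' W hreg
  have hQ := hQL F rfl n K hnK e W he heQ' hreg
  have hrow9 := hrow9L F rfl n K hnK e he.le he9' W hreg
  -- ### the feeds (px4 ✓p726284): `hT` at the bond patch, the curl currency at `Cc = 2`, the local curl letter, the peeled box mass
  have hT := hT_bondPatch F n K s hnK.le _ g hcg _ _ rfl rfl
  have hCurl := feedCu F n K s (c₀ F.L) hnK.le W _ g hcg _ _ rfl rfl hRN _ (fun _ _ => rfl) y
  have hCuW := feedCuW F n K s (c₀ F.L) hnK.le W _ g hcg _ _ rfl rfl hRN y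
  have hRin : ((2 * ((F.L ^ s : ℕ) : ℤ) + 1) * ((F.L ^ (K - n) : ℕ) : ℤ) + (((F.L ^ (K - n) : ℕ) : ℤ) - 1) / 2) - ((5 : ℕ) : ℤ) * ((F.L ^ (K - n) : ℕ) : ℤ) + ((5 : ℕ) : ℤ) * ((F.L ^ (K - n) : ℕ) : ℤ) = ((2 * ((F.L ^ s : ℕ) : ℤ) + 1) * ((F.L ^ (K - n) : ℕ) : ℤ) + (((F.L ^ (K - n) : ℕ) : ℤ) - 1) / 2) := sub_add_cancel _ _
  have hboxS := fun φ' : SiteL2K ℂ 3 (periodsT3 F K) (c₀ F.L) W₂ => feedBoxS F n K s (c₀ F.L) hR5 (fun κ => ((g κ * (F.L ^ s * F.L ^ (K - n)) : ℕ) : ZMod ((F.P K).sitesPerDir 0)) : Site (F.P K) 0) _ _ rfl rfl hRN hRin φ'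
  have hCu0 : (0 : ℝ) ≤ (∑ x ∈ Finset.univ.filter (fun x : Site (F.P K) 0 => ∀ κ : Fin 3,
          min ((iterBlockOf (K - n) x) κ - ((g κ * F.L ^ s : ℕ) : ZMod ((F.P K).sitesPerDir (K - n)))).val
            ((((g κ * F.L ^ s : ℕ) : ZMod ((F.P K).sitesPerDir (K - n)))) - (iterBlockOf (K - n) x) κ).val ≤ 2 * F.L ^ s + 2),
          c₀ F.L * ((F.L : ℝ) ^ (K - n)) ^ 2 * (∑ μ : Fin (F.P K).d, ∑ ν : Fin (F.P K).d, (if μ < ν then ∑ j : Fin 2, ∑ k : Fin 2,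
            ‖(curl (torusT (F.P K) 0) (fun κ z => unitsField (toUField W) ⟨z, κ⟩) (fun κ z => (toL2 F K (c₀ F.L)).symm y ⟨z, κ⟩) μ ν x) j k‖ ^ 2 else 0))) := by
    refine Finset.sum_nonneg fun x _ => mul_nonneg (by positivity) ?_
    refine Finset.sum_nonneg fun μ _ => Finset.sum_nonneg fun ν _ => ?_
    split_ifs
    · exact Finset.sum_nonneg fun j _ => Finset.sum_nonneg fun k _ => sq_nonneg _
    · exact le_rfl
  -- ### the nine per-patch rows (✓`patch_rows_one` = CORE ⊕ PEEL ⊕ budget), then the three feeds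
  obtain ⟨φ, κs, r, h1, h2, h3, h4, h5, h6, h7, h8, h9⟩ := patch_rows_one F n K s hnK (c₀ F.L) (cB F.L) W
    (fun κ => ((g κ * F.L ^ s : ℕ) : ZMod ((F.P K).sitesPerDir (K - n))) : Site (F.P K) (K - n)) _ hc _ _ rfl rfl hR hR1 hRN hRf hinj
    _ (fun _ _ => rfl) hα hαe he hw9 hreg hP hw hw4 y (by norm_num : (0 : ℝ) ≤ 2) hCu0 hCurl
    Z ζc ZE h01 hsupp hstep hsec hZ hZE hew hℓ4 hboxS _ hT hBq hBq' hBq'' he1 hQ hrow9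
    hL rfl he4 hsm hR5 hCT hTU1 hclose hCuW hC3
  refine ⟨φ, κs, r, _, _, _, h1, h2, h3, h4, h5, h6, h7, h8, h9, feedN F K (c₀ F.L) y _, le_rfl, ?_⟩
  rw [Finset.mul_sum, Finset.mul_sum]
  exact feedAs F n K s (fun κ => ((g κ * F.L ^ s : ℕ) : ZMod ((F.P K).sitesPerDir (K - n))) : Site (F.P K) (K - n)) g (fun _ => rfl) _ (peeled_margin F n K s hnK hR2 _ _ hc) _ (fun _ => by positivity)

end Summit.QuantumFields.YangMills.Theorems.Prop7DivRecoveryPatchRows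

end
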